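import Literature.AlgebraicGeometry.Resolution.AffineBlowupAlgebra
import Mathlib.RingTheory.Localization.Away.Basic
import Mathlib.RingTheory.Localization.AtPrime.Basic
import Mathlib.RingTheory.Localization.Ideal
import Mathlib.RingTheory.Localization.LocalizationLocalization
import HarnessLib

/-!
# [OURS · L1 W4.2] D18 (P2b-glue) G3a: CHART TRANSITION for the affine blowup algebras — at a point of `D₊(a) ∩ D₊(b)` the local rings
# of the charts `R[J/a]` and `R[J/b]` agree
# (cell res-hironaka, LADDER-RESOLUTION rung L; slot W4.2, crux chain w42 `SigmaMaxModificationsCorridor3` stmt-ResolutionOfSingularities-19249;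
# `--supports stmt-ResolutionOfSingularities-19249 --as helper`; res-L1-w42-plan-1 GO F-74 12:34:43Z «(P2b-glue)»; hand res-D-brk-3 (gen 6), cut G3
# of TAKING 13:03:41Z; G1 = `…Corridor3CPFrameBlowupGlue` p534278, G2 = `…Corridor3CPFramePointChart` p536675)

PURE COMMUTATIVE ALGEBRA, 0 `def`s, every declaration PROVED; OURS bookkeeping; NOT a statement of Hironaka's manuscript [Hironaka2017] nor of
[CossartJannsenSaito2020]/[CossartPiltant2019]. AI-written, weaker than expert review.

WHY. G2 presents the local ring of a point `x'` of the blow-up as a localisation of the chart algebra `B[J/g]` for the chart denominator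
`g = φ(c_j)` handed out by the stalk dictionary (Stacks 0804), while the hypersurface computation of res-D-pv-050 (p526498
`exists_monic_transform_ringEquiv`: `B[J/ū_{j₀}] ≅ R[I_J/u_{j₀}][X']/(h')`) needs the denominator to be one of the frame parameters `ū_{j₀}`.
This file moves between the two charts at the point:

* `exists_atPrime_ringEquiv_of_isLocalization_away` — ABSTRACT: if a ring `T` is simultaneously `R_a[1/u]` over `R_a` and `R_b[1/v]` over `R_b`
  (compatibly with a common base `R`), then for every prime `𝔔` of `R_a` with `u ∉ 𝔔` there is a prime `𝔔''` of `R_b` with `v ∉ 𝔔''`, the same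
  contraction to `R`, and `(R_a)_𝔔 ≅ (R_b)_{𝔔''}` over `R` (both are `T_{𝔔T}`: Mathlib `isLocalization_isLocalization_atPrime_isLocalization`).
* `blowupAlgebra.exists_isLocalization_away_pair` — CONCRETE: for `a, b ∈ J` the intersection chart `T = R[J/a][a/b] = R[J/b][b/a] ⊆ R[1/a][1/b]`
  (the subalgebra generated by the `x/a` and the `x/b`, `x ∈ J`) is `R[J/a]` localised away from `b/a` AND `R[J/b]` localised away from `a/b`
  (Stacks 0804: `D₊(a) ∩ D₊(b) = D₊(ab)`; GW (13.19)).
* **`blowupAlgebra.exists_atPrime_ringEquiv_of_not_mem`** — THE TRANSITION: for a prime `𝔔` of `R[J/a]` not containing `b/a` there is a prime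
  `𝔔''` of `R[J/b]` not containing `a/b`, with `𝔔'' ∩ R = 𝔔 ∩ R` and `(R[J/a])_𝔔 ≅ (R[J/b])_{𝔔''}` over `R`.
* **`blowupAlgebra.exists_div_not_mem_of_relation`** (G3b, the hypersurface) — for `w, v₁, …, v_r ∈ J` with a monic relation
  `w^m + Σ_{i<m} c_i w^i = 0`, `c_i ∈ (v)^{m-i}` (the equation `h` of a CP frame read along the centre `V(X̄, ū_J)`, `h_i ∈ I_J^{m-i}`), and ANY
  chart denominator `g ∈ (w, v)`: every prime of `B[J/g]` misses some `v_{j₀}/g` — so the local ring of every point of the blow-up of the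
  hypersurface along the centre is read on a `v_{j₀}`-chart (no directrix argument needed).

References: The Stacks Project, Tag 0804 [StacksProject]; Görtz–Wedhorn I (13.19), Prop. 13.91 [GortzWedhorn2020]; tree `Resolution/AffineBlowupAlgebra`
(`blowupAlgebra`, `div_mem_blowupAlgebra`); HOME STATUS res-D-brk-3 13:03:41Z (cut G1–G5), 14:01:41Z (G2 filed).
-/

noncomputable section

set_option linter.dupNamespace false

open IsLocalRing IsLocalization
open Literature.AlgebraicGeometry.Resolution
open scoped Pointwise

universe u

namespace Summit.ResolutionOfSingularities.ResolutionOfSingularities.Theorems.SigmaMaxModificationsCorridor3.Helpers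

/-! ## Abstract: two rings with a common localisation have the same local rings on the common chart -/

/-- [OURS · L1 W4.2] **Local rings on a common chart.** Let `T` be an `R_a`-algebra which is the localisation of `R_a` away from `u` and an
`R_b`-algebra which is the localisation of `R_b` away from `v`, compatibly with a common base ring `R`. For a prime `𝔔` of `R_a` with
`u ∉ 𝔔`: `𝔔'' := (𝔔T) ∩ R_b` is a prime of `R_b` with `v ∉ 𝔔''` and the same contraction to `R`, and `(R_a)_𝔔 ≅ (R_b)_{𝔔''}` compatibly with
`R` — both are the localisation of `T` at `𝔔T`. [cite: StacksProject, Tag 0804] -/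
theorem exists_atPrime_ringEquiv_of_isLocalization_away {R Ra Rb T : Type*} [CommRing R] [CommRing Ra] [CommRing Rb] [CommRing T]
    [Algebra R Ra] [Algebra R Rb] [Algebra Ra T] [Algebra Rb T] (u : Ra) (v : Rb)
    [IsLocalization.Away u T] [IsLocalization.Away v T]
    (hcomp : ∀ r : R, algebraMap Ra T (algebraMap R Ra r) = algebraMap Rb T (algebraMap R Rb r))
    (𝔔 : Ideal Ra) [𝔔.IsPrime] (hu : u ∉ 𝔔) :
    ∃ (𝔔'' : Ideal Rb) (_ : 𝔔''.IsPrime), v ∉ 𝔔'' ∧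
      (∀ r : R, algebraMap R Rb r ∈ 𝔔'' ↔ algebraMap R Ra r ∈ 𝔔) ∧
      ∃ e : Localization.AtPrime 𝔔 ≃+* Localization.AtPrime 𝔔'',
        ∀ r : R, e (algebraMap Ra (Localization.AtPrime 𝔔) (algebraMap R Ra r)) =
          algebraMap Rb (Localization.AtPrime 𝔔'') (algebraMap R Rb r) := by
  have hdisj : Disjoint (Submonoid.powers u : Set Ra) 𝔔 := (Ideal.disjoint_powers_iff_notMem_of_isPrime u).mpr hu
  haveI h𝔔T : (𝔔.map (algebraMap Ra T)).IsPrime := IsLocalization.isPrime_of_isPrime_disjoint (Submonoid.powers u) T 𝔔 ‹_› hdisj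
  have hca : (𝔔.map (algebraMap Ra T)).comap (algebraMap Ra T) = 𝔔 := by
    have h := IsLocalization.under_map_of_isPrime_disjoint (Submonoid.powers u) T ‹𝔔.IsPrime› hdisj
    rwa [Ideal.under_def] at h
  -- the prime of `R_b`
  refine ⟨(𝔔.map (algebraMap Ra T)).comap (algebraMap Rb T), Ideal.comap_isPrime _ _, fun hv => ?_, fun r => ?_, ?_⟩
  · -- `v` is a unit of `T`, so not in the proper ideal `𝔔T`
    have hvu : IsUnit (algebraMap Rb T v) := IsLocalization.Away.algebraMap_isUnit v
    exact h𝔔T.ne_top (Ideal.eq_top_of_isUnit_mem _ (Ideal.mem_comap.mp hv) hvu)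
  · rw [Ideal.mem_comap, ← hcomp, ← Ideal.mem_comap, hca]
  · -- both local rings are `T_{𝔔T}`
    haveI : IsScalarTower Ra T (Localization.AtPrime (𝔔.map (algebraMap Ra T))) := IsScalarTower.of_algebraMap_eq' rfl
    haveI : IsScalarTower Rb T (Localization.AtPrime (𝔔.map (algebraMap Ra T))) := IsScalarTower.of_algebraMap_eq' rfl
    have hM : ((𝔔.map (algebraMap Ra T)).comap (algebraMap Ra T)).primeCompl = 𝔔.primeCompl := by
      ext x
      rw [Ideal.mem_primeCompl_iff, Ideal.mem_primeCompl_iff, hca]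
    have hA : IsLocalization.AtPrime (Localization.AtPrime (𝔔.map (algebraMap Ra T))) 𝔔 := by
      have h := IsLocalization.isLocalization_isLocalization_atPrime_isLocalization (Submonoid.powers u)
        (T := Localization.AtPrime (𝔔.map (algebraMap Ra T))) (𝔔.map (algebraMap Ra T))
      change IsLocalization _ _ at h
      change IsLocalization _ _
      rwa [hM] at h
    have hB : IsLocalization.AtPrime (Localization.AtPrime (𝔔.map (algebraMap Ra T)))
        ((𝔔.map (algebraMap Ra T)).comap (algebraMap Rb T)) :=
      IsLocalization.isLocalization_isLocalization_atPrime_isLocalization (Submonoid.powers v)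
        (T := Localization.AtPrime (𝔔.map (algebraMap Ra T))) (𝔔.map (algebraMap Ra T))
    let eA : Localization.AtPrime 𝔔 ≃ₐ[Ra] Localization.AtPrime (𝔔.map (algebraMap Ra T)) :=
      @IsLocalization.algEquiv Ra _ 𝔔.primeCompl (Localization.AtPrime 𝔔) _ _ _ _ _ _ hA
    let eB : Localization.AtPrime ((𝔔.map (algebraMap Ra T)).comap (algebraMap Rb T)) ≃ₐ[Rb]
        Localization.AtPrime (𝔔.map (algebraMap Ra T)) :=
      @IsLocalization.algEquiv Rb _ ((𝔔.map (algebraMap Ra T)).comap (algebraMap Rb T)).primeCompl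
        (Localization.AtPrime ((𝔔.map (algebraMap Ra T)).comap (algebraMap Rb T))) _ _ _ _ _ _ hB
    refine ⟨eA.toRingEquiv.trans eB.symm.toRingEquiv, fun r => ?_⟩
    change eB.symm (eA (algebraMap Ra (Localization.AtPrime 𝔔) (algebraMap R Ra r))) = _
    rw [AlgEquiv.symm_apply_eq, AlgEquiv.commutes, AlgEquiv.commutes, IsScalarTower.algebraMap_apply Ra T,
      IsScalarTower.algebraMap_apply Rb T, hcomp]

/-! ## Concrete: the intersection chart `R[J/a][a/b] = R[J/b][b/a]` of two charts of an affine blow-up -/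

namespace blowupAlgebra

variable {R : Type u} [CommRing R] (J : Ideal R) {a b : R}

/-- [OURS · L1 W4.2] **The intersection chart.** For `a, b ∈ J`, inside `L = R[1/a][1/b]` the `R`-subalgebra `T` generated by the `x/a` and
the `x/b` (`x ∈ J`) receives `R[J/a]` and `R[J/b]`, and is the localisation of `R[J/a]` away from `b/a` AND of `R[J/b]` away from `a/b`,
compatibly with `R` (Stacks 0804: `D₊(a) ∩ D₊(b)`). Stated as the existence of such a `T`. [cite: StacksProject, Tag 0804] -/
theorem exists_isLocalization_away_pair (ha : a ∈ J) (hb : b ∈ J) :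
    ∃ (T : Type u) (_ : CommRing T) (_ : Algebra (blowupAlgebra J a) T) (_ : Algebra (blowupAlgebra J b) T),
      IsLocalization.Away (⟨algebraMap R (Localization.Away a) b * IsLocalization.Away.invSelf a, div_mem_blowupAlgebra J a hb⟩ :
        blowupAlgebra J a) T ∧
      IsLocalization.Away (⟨algebraMap R (Localization.Away b) a * IsLocalization.Away.invSelf b, div_mem_blowupAlgebra J b ha⟩ :
        blowupAlgebra J b) T ∧
      ∀ r : R, algebraMap (blowupAlgebra J a) T (algebraMap R (blowupAlgebra J a) r) =
        algebraMap (blowupAlgebra J b) T (algebraMap R (blowupAlgebra J b) r) := by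
  -- the ambient ring `L = R[1/a][1/b]` and the two structure maps
  let La := Localization.Away a
  let Lb := Localization.Away b
  let L := Localization.Away (algebraMap R La b)
  let ιa : La →+* L := algebraMap La L
  have hιa : ∀ r : R, ιa (algebraMap R La r) = algebraMap R L r := fun r => (IsScalarTower.algebraMap_apply R La L r).symm
  have hbu : IsUnit (algebraMap R L b) := by
    rw [IsScalarTower.algebraMap_apply R La L]
    exact IsLocalization.Away.algebraMap_isUnit (algebraMap R La b)
  have habu : IsUnit (algebraMap R L (a * b)) := IsLocalization.Away.algebraMap_isUnit (a * b)
  have hau : IsUnit (algebraMap R L a) := by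
    rw [map_mul] at habu
    exact (IsUnit.mul_iff.mp habu).1
  let ιb : Lb →+* L := IsLocalization.Away.lift b (g := algebraMap R L) hbu
  have hιb : ∀ r : R, ιb (algebraMap R Lb r) = algebraMap R L r := fun r => IsLocalization.Away.lift_eq b hbu r
  -- `L` is also `R[1/b][1/a]`
  letI algLb : Algebra Lb L := ιb.toAlgebra
  haveI : IsScalarTower R Lb L := IsScalarTower.of_algebraMap_eq fun r => by
    rw [RingHom.algebraMap_toAlgebra]; exact (hιb r).symm
  haveI hLb : IsLocalization.Away (algebraMap R Lb a) L := IsLocalization.Away.commutes Lb La L b a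
  -- the inverses of `a` and `b` in `L`
  let ia : L := ιa (IsLocalization.Away.invSelf a)
  let ib : L := ιb (IsLocalization.Away.invSelf b)
  have haia : algebraMap R L a * ia = 1 := by
    change algebraMap R L a * ιa _ = 1
    rw [← hιa, ← map_mul, IsLocalization.Away.mul_invSelf, map_one]
  have hbib : algebraMap R L b * ib = 1 := by
    change algebraMap R L b * ιb _ = 1
    rw [← hιb, ← map_mul, IsLocalization.Away.mul_invSelf, map_one]
  -- images of the generators
  have hgenA : ∀ x : R, ιa (algebraMap R La x * IsLocalization.Away.invSelf a) = algebraMap R L x * ia := fun x => by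
    change ιa _ = algebraMap R L x * ιa _
    rw [map_mul, hιa]
  have hgenB : ∀ x : R, ιb (algebraMap R Lb x * IsLocalization.Away.invSelf b) = algebraMap R L x * ib := fun x => by
    change ιb _ = algebraMap R L x * ιb _
    rw [map_mul, hιb]
  -- the intersection chart
  let G : Set L := ιa '' blowupAlgebraGens J a ∪ ιb '' blowupAlgebraGens J b
  let T : Subalgebra R L := Algebra.adjoin R G
  have hmemA : ∀ z : blowupAlgebra J a, ιa z ∈ T := by
    rintro ⟨z, hz⟩
    change ιa z ∈ T
    induction hz using Algebra.adjoin_induction with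
    | mem x hx => exact Algebra.subset_adjoin (Or.inl ⟨x, hx, rfl⟩)
    | algebraMap r => rw [hιa]; exact Subalgebra.algebraMap_mem _ r
    | add x y _ _ hx hy => rw [map_add]; exact add_mem hx hy
    | mul x y _ _ hx hy => rw [map_mul]; exact mul_mem hx hy
  have hmemB : ∀ z : blowupAlgebra J b, ιb z ∈ T := by
    rintro ⟨z, hz⟩
    change ιb z ∈ T
    induction hz using Algebra.adjoin_induction with
    | mem x hx => exact Algebra.subset_adjoin (Or.inr ⟨x, hx, rfl⟩)
    | algebraMap r => rw [hιb]; exact Subalgebra.algebraMap_mem _ r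
    | add x y _ _ hx hy => rw [map_add]; exact add_mem hx hy
    | mul x y _ _ hx hy => rw [map_mul]; exact mul_mem hx hy
  let ρa : blowupAlgebra J a →+* T := (ιa.comp (blowupAlgebra J a).val.toRingHom).codRestrict T fun z => hmemA z
  let ρb : blowupAlgebra J b →+* T := (ιb.comp (blowupAlgebra J b).val.toRingHom).codRestrict T fun z => hmemB z
  have hρa : ∀ z : blowupAlgebra J a, ((ρa z : T) : L) = ιa z := fun z => rfl
  have hρb : ∀ z : blowupAlgebra J b, ((ρb z : T) : L) = ιb z := fun z => rfl
  letI algA : Algebra (blowupAlgebra J a) T := ρa.toAlgebra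
  letI algB : Algebra (blowupAlgebra J b) T := ρb.toAlgebra
  -- the two distinguished elements `b/a ∈ R[J/a]`, `a/b ∈ R[J/b]` and their images
  set ba : blowupAlgebra J a := ⟨algebraMap R La b * IsLocalization.Away.invSelf a, div_mem_blowupAlgebra J a hb⟩ with hba
  set ab : blowupAlgebra J b := ⟨algebraMap R Lb a * IsLocalization.Away.invSelf b, div_mem_blowupAlgebra J b ha⟩ with hab
  have hbaL : ((algebraMap _ T ba : T) : L) = algebraMap R L b * ia := hgenA b
  have habL : ((algebraMap _ T ab : T) : L) = algebraMap R L a * ib := hgenB a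
  have hprod : (algebraMap R L b * ia) * (algebraMap R L a * ib) = 1 := by
    calc (algebraMap R L b * ia) * (algebraMap R L a * ib) = (algebraMap R L a * ia) * (algebraMap R L b * ib) := by ring
      _ = 1 := by rw [haia, hbib, one_mul]
  have hunitA : IsUnit (algebraMap _ T ba) :=
    isUnit_iff_exists_inv.mpr ⟨algebraMap _ T ab, Subtype.ext (by rw [Subalgebra.coe_mul, hbaL, habL, hprod]; rfl)⟩
  have hunitB : IsUnit (algebraMap _ T ab) :=
    isUnit_iff_exists_inv.mpr ⟨algebraMap _ T ba, Subtype.ext (by rw [Subalgebra.coe_mul, hbaL, habL, mul_comm, hprod]; rfl)⟩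
  -- the surjectivity clauses, proved on `L` by induction over the generators
  have hsurjA : ∀ z ∈ T, ∃ (n : ℕ) (r : blowupAlgebra J a), z * (algebraMap R L b * ia) ^ n = ιa r := by
    intro z hz
    induction hz using Algebra.adjoin_induction with
    | mem x hx =>
      rcases hx with ⟨y, hy, rfl⟩ | ⟨y, hy, rfl⟩
      · exact ⟨0, ⟨y, Algebra.subset_adjoin hy⟩, by rw [pow_zero, mul_one]⟩
      · obtain ⟨x, hx, rfl⟩ := hy
        refine ⟨1, ⟨_, div_mem_blowupAlgebra J a hx⟩, ?_⟩
        rw [hgenB, hgenA, pow_one]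
        calc algebraMap R L x * ib * (algebraMap R L b * ia) = algebraMap R L x * ia * (algebraMap R L b * ib) := by ring
          _ = algebraMap R L x * ia := by rw [hbib, mul_one]
    | algebraMap r => exact ⟨0, algebraMap R _ r, by rw [pow_zero, mul_one]; exact (hιa r).symm⟩
    | add x y _ _ hx hy =>
      obtain ⟨n₁, r₁, h₁⟩ := hx
      obtain ⟨n₂, r₂, h₂⟩ := hy
      refine ⟨n₁ + n₂, r₁ * ba ^ n₂ + r₂ * ba ^ n₁, ?_⟩
      rw [Subalgebra.coe_add, Subalgebra.coe_mul, Subalgebra.coe_mul, Subalgebra.coe_pow, Subalgebra.coe_pow, map_add, map_mul,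
        map_mul, map_pow, map_pow, hgenA, ← h₁, ← h₂]
      ring
    | mul x y _ _ hx hy =>
      obtain ⟨n₁, r₁, h₁⟩ := hx
      obtain ⟨n₂, r₂, h₂⟩ := hy
      refine ⟨n₁ + n₂, r₁ * r₂, ?_⟩
      rw [Subalgebra.coe_mul, map_mul, ← h₁, ← h₂]
      ring
  have hsurjB : ∀ z ∈ T, ∃ (n : ℕ) (r : blowupAlgebra J b), z * (algebraMap R L a * ib) ^ n = ιb r := by
    intro z hz
    induction hz using Algebra.adjoin_induction with
    | mem x hx =>
      rcases hx with ⟨y, hy, rfl⟩ | ⟨y, hy, rfl⟩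
      · obtain ⟨x, hx, rfl⟩ := hy
        refine ⟨1, ⟨_, div_mem_blowupAlgebra J b hx⟩, ?_⟩
        rw [hgenA, hgenB, pow_one]
        calc algebraMap R L x * ia * (algebraMap R L a * ib) = algebraMap R L x * ib * (algebraMap R L a * ia) := by ring
          _ = algebraMap R L x * ib := by rw [haia, mul_one]
      · exact ⟨0, ⟨y, Algebra.subset_adjoin hy⟩, by rw [pow_zero, mul_one]⟩
    | algebraMap r => exact ⟨0, algebraMap R _ r, by rw [pow_zero, mul_one]; exact (hιb r).symm⟩
    | add x y _ _ hx hy =>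
      obtain ⟨n₁, r₁, h₁⟩ := hx
      obtain ⟨n₂, r₂, h₂⟩ := hy
      refine ⟨n₁ + n₂, r₁ * ab ^ n₂ + r₂ * ab ^ n₁, ?_⟩
      rw [Subalgebra.coe_add, Subalgebra.coe_mul, Subalgebra.coe_mul, Subalgebra.coe_pow, Subalgebra.coe_pow, map_add, map_mul,
        map_mul, map_pow, map_pow, hgenB, ← h₁, ← h₂]
      ring
    | mul x y _ _ hx hy =>
      obtain ⟨n₁, r₁, h₁⟩ := hx
      obtain ⟨n₂, r₂, h₂⟩ := hy
      refine ⟨n₁ + n₂, r₁ * r₂, ?_⟩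
      rw [Subalgebra.coe_mul, map_mul, ← h₁, ← h₂]
      ring
  refine ⟨T, inferInstance, algA, algB, ?_, ?_, fun r => Subtype.ext ?_⟩
  · refine IsLocalization.Away.mk ba hunitA (fun s => ?_) (fun r₁ r₂ h => ?_)
    · obtain ⟨n, r, hr⟩ := hsurjA s s.2
      refine ⟨n, r, Subtype.ext ?_⟩
      rw [Subalgebra.coe_mul, Subalgebra.coe_pow, hbaL]
      exact hr
    · -- `ιa r₁ = ιa r₂` in `L = La[1/b]`: some `bⁿ` kills the difference in `La`, hence `(b/a)ⁿ` does in `R[J/a]`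
      have h' : ιa (r₁ : La) = ιa (r₂ : La) := by rw [← hρa, ← hρa]; exact congrArg Subtype.val h
      obtain ⟨⟨_, n, rfl⟩, hn⟩ := IsLocalization.exists_of_eq (M := Submonoid.powers (algebraMap R La b)) h'
      refine ⟨n, Subtype.ext ?_⟩
      have hn' : algebraMap R La b ^ n * (r₁ : La) = algebraMap R La b ^ n * (r₂ : La) := hn
      change ((ba ^ n * r₁ : blowupAlgebra J a) : La) = ((ba ^ n * r₂ : blowupAlgebra J a) : La)
      rw [Subalgebra.coe_mul, Subalgebra.coe_mul, Subalgebra.coe_pow, hba, Subtype.coe_mk, mul_pow,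
        mul_comm (algebraMap R La b ^ n) (IsLocalization.Away.invSelf a ^ n), mul_assoc, mul_assoc, hn']
  · refine IsLocalization.Away.mk ab hunitB (fun s => ?_) (fun r₁ r₂ h => ?_)
    · obtain ⟨n, r, hr⟩ := hsurjB s s.2
      refine ⟨n, r, Subtype.ext ?_⟩
      rw [Subalgebra.coe_mul, Subalgebra.coe_pow, habL]
      exact hr
    · have h' : ιb (r₁ : Lb) = ιb (r₂ : Lb) := by rw [← hρb, ← hρb]; exact congrArg Subtype.val h
      have h'' : algebraMap Lb L (r₁ : Lb) = algebraMap Lb L (r₂ : Lb) := h'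
      obtain ⟨⟨_, n, rfl⟩, hn⟩ := IsLocalization.exists_of_eq (M := Submonoid.powers (algebraMap R Lb a)) h''
      refine ⟨n, Subtype.ext ?_⟩
      have hn' : algebraMap R Lb a ^ n * (r₁ : Lb) = algebraMap R Lb a ^ n * (r₂ : Lb) := hn
      change ((ab ^ n * r₁ : blowupAlgebra J b) : Lb) = ((ab ^ n * r₂ : blowupAlgebra J b) : Lb)
      rw [Subalgebra.coe_mul, Subalgebra.coe_mul, Subalgebra.coe_pow, hab, Subtype.coe_mk, mul_pow,
        mul_comm (algebraMap R Lb a ^ n) (IsLocalization.Away.invSelf b ^ n), mul_assoc, mul_assoc, hn']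
  · change ιa (((algebraMap R (blowupAlgebra J a) r : blowupAlgebra J a) : La)) = ιb (((algebraMap R (blowupAlgebra J b) r : _) : Lb))
    rw [Subalgebra.coe_algebraMap, Subalgebra.coe_algebraMap, hιa, hιb]

/-- [OURS · L1 W4.2] **CHART TRANSITION for affine blowup algebras.** For `a, b ∈ J` and a prime `𝔔` of `R[J/a]` not containing `b/a` (the point
lies in `D₊(a) ∩ D₊(b)`), there is a prime `𝔔''` of `R[J/b]` not containing `a/b`, with the same contraction to `R`, and a ring isomorphism
`(R[J/a])_𝔔 ≅ (R[J/b])_{𝔔''}` compatible with `R`. [cite: StacksProject, Tag 0804] -/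
theorem exists_atPrime_ringEquiv_of_not_mem (ha : a ∈ J) (hb : b ∈ J) (𝔔 : Ideal (blowupAlgebra J a)) [𝔔.IsPrime]
    (h𝔔 : (⟨algebraMap R (Localization.Away a) b * IsLocalization.Away.invSelf a, div_mem_blowupAlgebra J a hb⟩ :
      blowupAlgebra J a) ∉ 𝔔) :
    ∃ (𝔔'' : Ideal (blowupAlgebra J b)) (_ : 𝔔''.IsPrime),
      (⟨algebraMap R (Localization.Away b) a * IsLocalization.Away.invSelf b, div_mem_blowupAlgebra J b ha⟩ : blowupAlgebra J b) ∉ 𝔔'' ∧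
      (∀ r : R, algebraMap R (blowupAlgebra J b) r ∈ 𝔔'' ↔ algebraMap R (blowupAlgebra J a) r ∈ 𝔔) ∧
      ∃ e : Localization.AtPrime 𝔔 ≃+* Localization.AtPrime 𝔔'',
        ∀ r : R, e (algebraMap (blowupAlgebra J a) (Localization.AtPrime 𝔔) (algebraMap R (blowupAlgebra J a) r)) =
          algebraMap (blowupAlgebra J b) (Localization.AtPrime 𝔔'') (algebraMap R (blowupAlgebra J b) r) := by
  obtain ⟨T, _, _, _, hTa, hTb, hcomp⟩ := exists_isLocalization_away_pair J ha hb
  exact exists_atPrime_ringEquiv_of_isLocalization_away _ _ hcomp 𝔔 h𝔔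

/-! ## The hypersurface: every point of the blow-up of `V(w, v)` lies in a `v_{j₀}`-chart -/

/-- [OURS · L1 W4.2] **On the blow-up of a hypersurface along an equimultiple centre `V(w, v₁, …, v_r)`, no point lies only in the
`w`-chart.** Let `B` be a ring with elements `w, v₁, …, v_r ∈ J` and a monic relation `w^m + Σ_{i<m} c_i w^i = 0` whose coefficients satisfy
`c_i ∈ (v)^{m-i}` (a CP-frame hypersurface `R[X]/(h)` read along the centre: `w = X̄`, `v = ū_J`, `c_i = h_i`, `h_i ∈ I_J^{m-i}`), and `g` any chart
denominator from `(w, v)`. Then for every prime `𝔔` of the chart algebra `B[J/g]` some `v_{j₀}/g ∉ 𝔔`: dividing the relation by `g^m` gives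
`(w/g)^m ∈ (v₁/g, …, v_r/g)`, so if all `v_j/g ∈ 𝔔` then `w/g ∈ 𝔔` and `1 = g/g ∈ (w/g, v_j/g) ⊆ 𝔔`. This replaces «the near point lies in a
`u_{j₀}`-chart by the directrix» in the D18 chain. [folklore] -/
theorem exists_div_not_mem_of_relation {B : Type u} [CommRing B] (J : Ideal B) {g w : B} {r : ℕ} {v : Fin r → B}
    (hw : w ∈ J) (hv : ∀ j, v j ∈ J) (hg : g ∈ Ideal.span (insert w (Set.range v)))
    {m : ℕ} {c : ℕ → B} (hc : ∀ i < m, c i ∈ Ideal.span (Set.range v) ^ (m - i))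
    (hrel : w ^ m + ∑ i ∈ Finset.range m, c i * w ^ i = 0)
    (𝔔 : Ideal (blowupAlgebra J g)) [𝔔.IsPrime] :
    ∃ j₀ : Fin r, (⟨algebraMap B (Localization.Away g) (v j₀) * IsLocalization.Away.invSelf g, div_mem_blowupAlgebra J g (hv j₀)⟩ :
      blowupAlgebra J g) ∉ 𝔔 := by
  classical
  -- the players on the chart algebra `(blowupAlgebra J g) = B[J/g]`
  set G : (blowupAlgebra J g) := algebraMap B (blowupAlgebra J g) g with hG
  set W : (blowupAlgebra J g) := ⟨algebraMap B (Localization.Away g) w * IsLocalization.Away.invSelf g, div_mem_blowupAlgebra J g hw⟩ with hW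
  let V : Fin r → (blowupAlgebra J g) := fun j => ⟨algebraMap B (Localization.Away g) (v j) * IsLocalization.Away.invSelf g, div_mem_blowupAlgebra J g (hv j)⟩
  have hGW : algebraMap B (blowupAlgebra J g) w = G * W := Subtype.ext (by
    rw [Subalgebra.coe_mul, hG, Subalgebra.coe_algebraMap, Subalgebra.coe_algebraMap, hW, Subtype.coe_mk, mul_comm, div_mul_algebraMap])
  have hGV : ∀ j, algebraMap B (blowupAlgebra J g) (v j) = G * V j := fun j => Subtype.ext (by
    rw [Subalgebra.coe_mul, hG, Subalgebra.coe_algebraMap, Subalgebra.coe_algebraMap, Subtype.coe_mk, mul_comm, div_mul_algebraMap])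
  have hGnzd : G ∈ nonZeroDivisors (blowupAlgebra J g) := algebraMap_mem_nonZeroDivisors_blowupAlgebra
  by_contra hall
  simp only [not_exists, not_not] at hall
  set 𝔞 : Ideal (blowupAlgebra J g) := Ideal.span (Set.range V) with h𝔞
  have h𝔞𝔔 : 𝔞 ≤ 𝔔 := Ideal.span_le.mpr (by rintro _ ⟨j, rfl⟩; exact hall j)
  -- `(v) ↦ G · 𝔞` along `B → B[J/g]`
  have hmapv : (Ideal.span (Set.range v)).map (algebraMap B (blowupAlgebra J g)) = Ideal.span {G} * 𝔞 := by
    rw [Ideal.map_span, h𝔞, Ideal.span_mul_span', Set.singleton_mul, ← Set.range_comp, ← Set.range_comp]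
    exact congrArg Ideal.span (congrArg Set.range (funext fun j => hGV j))
  have hmapvpow : ∀ k : ℕ, (Ideal.span (Set.range v) ^ k).map (algebraMap B (blowupAlgebra J g)) = Ideal.span {G ^ k} * 𝔞 ^ k := fun k => by
    rw [Ideal.map_pow, hmapv, mul_pow, Ideal.span_singleton_pow]
  -- the coefficients divided by `g^{m-i}`
  have key : ∀ i, i < m → ∃ y : (blowupAlgebra J g), y ∈ 𝔞 ∧ algebraMap B (blowupAlgebra J g) (c i) = G ^ (m - i) * y := by
    intro i hi
    have h1 : algebraMap B (blowupAlgebra J g) (c i) ∈ Ideal.span {G ^ (m - i)} * 𝔞 ^ (m - i) := by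
      rw [← hmapvpow]
      exact Ideal.mem_map_of_mem _ (hc i hi)
    obtain ⟨y, hy, hyeq⟩ := Ideal.mem_span_singleton_mul.mp h1
    exact ⟨y, Ideal.pow_le_self (by omega) hy, hyeq.symm⟩
  choose! y hy𝔞 hyeq using key
  -- the relation divided by `g^m`: `W^m + Σ y_i W^i = 0`
  have hrelS : G ^ m * (W ^ m + ∑ i ∈ Finset.range m, y i * W ^ i) = 0 := by
    have h := congrArg (algebraMap B (blowupAlgebra J g)) hrel
    rw [map_add, map_pow, map_sum, map_zero, hGW, mul_pow] at h
    rw [mul_add, Finset.mul_sum, ← h]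
    congr 1
    refine Finset.sum_congr rfl fun i hi => ?_
    have hi' : i < m := Finset.mem_range.mp hi
    have hGpow : G ^ m = G ^ (m - i) * G ^ i := by rw [← pow_add, Nat.sub_add_cancel hi'.le]
    rw [map_mul, map_pow, hGW, hyeq i hi', mul_pow, hGpow]
    ring
  have hrelS' : W ^ m + ∑ i ∈ Finset.range m, y i * W ^ i = 0 :=
    (mul_left_mem_nonZeroDivisors_eq_zero_iff (pow_mem hGnzd m)).mp hrelS
  -- hence `W^m ∈ 𝔞 ⊆ 𝔔`, `W ∈ 𝔔`
  have hWm : W ^ m ∈ 𝔔 := by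
    have : W ^ m = -(∑ i ∈ Finset.range m, y i * W ^ i) := eq_neg_of_add_eq_zero_left hrelS'
    rw [this, Ideal.neg_mem_iff]
    exact Ideal.sum_mem _ fun i hi => Ideal.mul_mem_right _ _ (h𝔞𝔔 (hy𝔞 i (Finset.mem_range.mp hi)))
  have hW𝔔 : W ∈ 𝔔 := Ideal.IsPrime.mem_of_pow_mem ‹_› m hWm
  -- and `1 = g/g ∈ (W, V) ⊆ 𝔔`
  have himg : algebraMap B (blowupAlgebra J g) '' insert w (Set.range v) =
      ({G} : Set (blowupAlgebra J g)) * insert W (Set.range V) := by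
    rw [Set.image_insert_eq, ← Set.range_comp, Set.singleton_mul, Set.image_insert_eq, ← Set.range_comp, hGW]
    congr 1
    exact congrArg Set.range (funext fun j => hGV j)
  have hGmem : G ∈ Ideal.span {G} * Ideal.span (insert W (Set.range V)) := by
    rw [Ideal.span_mul_span', ← himg, ← Ideal.map_span]
    exact Ideal.mem_map_of_mem _ hg
  obtain ⟨t, ht, hGt⟩ := Ideal.mem_span_singleton_mul.mp hGmem
  have ht𝔔 : t ∈ 𝔔 := by
    refine (Ideal.span_le.mpr ?_) ht
    rintro _ (rfl | ⟨j, rfl⟩)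
    · exact hW𝔔
    · exact hall j
  have h1t : (1 : (blowupAlgebra J g)) - t = 0 := by
    refine (mul_left_mem_nonZeroDivisors_eq_zero_iff hGnzd).mp ?_
    rw [mul_sub, mul_one, hGt, sub_self]
  exact (Ideal.IsPrime.ne_top ‹_›) ((Ideal.eq_top_iff_one _).mpr ((sub_eq_zero.mp h1t).symm ▸ ht𝔔))

end blowupAlgebra

end Summit.ResolutionOfSingularities.ResolutionOfSingularities.Theorems.SigmaMaxModificationsCorridor3.Helpers

end
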